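import Summits.Ventures.HSemireg.WedgeHankelBox
import Summits.Ventures.HSemireg.WedgeHankelSiegel

/-!
# Venture HSemireg — THE SIEGEL DIRECTIONS OF EVERY FACTOR KILL EVERY HANKEL BOX: `⊕_i emb_i(Siegel_{m_i}) ≤ ker(θ ↦ θ ∧ (v₀ ∧ ⋯ ∧ v_{n−1}) ∣ ⋀²)`,
# a named kernel of dimension `Σ_i m_i(m_i+1)/2`, uniform in the number of factors, their dimensions and their classes

HONEST FRAMING. Part of the Lean index of the computation cell `pub-hsemireg` (seat p10 gen 10, Sunday typer «UNIFORM-IN-n»).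
Finite-dimensional EXTERIOR ALGEBRA over a field ONLY: no variety, no cohomology theory, no sheaf, no Ext group and no semiregularity map is
constructed here; nothing here says that HC / HC_CM / HC_AV holds; no Literature fact is declared or used.  Custodian versions cited:
theory/FORMULA-N.md PART A §2.3 THEOREM K, §2.6 THEOREM H / FN-4 (i) («v-independent kernel the Θ-isotropic part»); STRUCTURE.md v1.0-SIGNED
9b196a05977dd067 §1.1 C15 / Σ2.  Dictionary QUOTED, never asserted (`s^{(i)}_{ab} ↔ ∂_a ∧ dz̄_b + ∂_b ∧ dz̄_a` on the factor `X_i`: the Siegel /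
polarisation-preserving deformation directions of `X_i`; `⌟(v₀ ⊠ ⋯ ⊠ v_{n−1})` on `HT²(X₀ × ⋯ × X_{n−1})` ↦ `θ ↦ θ ∧ F`).

This file COMPOSES p10 g10's leaf #1 (`WedgeHankelBox`: the Hankel box `F = v₀ ∧ ⋯ ∧ v_{n−1}`, `v_i = w_{m_i}(q_i)` embedded in block `i`) with
leaf #5 (`WedgeHankelSiegel`: `Siegel_m ∧ w_m(q) = 0`).  Results (every field, every `n`, every dimensions `m_i`, EVERY sequences `q_i`):
* §1 even homogeneous elements commute with homogeneous elements (generic index type; `even_mul_comm`); the Siegel space is homogeneous of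
  degree `2` (`siegel_le_Hom_two`).
* §2 **`emb_siegel_mul_hankelBox`: for every factor `i < n` and every `θ₀ ∈ Siegel_{m_i}`, `emb_i(θ₀) ∧ F = 0`** — the embedded Siegel
  2-vector commutes past the earlier factors (even × homogeneous) and kills its own (`emb_i(θ₀) ∧ emb_i(w_{m_i}(q_i)) = emb_i(θ₀ ∧ w) = 0`);
  the later factors are multiplied on the right.
* §3 **`map_siegel_le_ker_hankelBox`: `emb_i(Siegel_{m_i}) ≤ ker(θ ↦ θ ∧ F ∣ ⋀²)`** and **`two_mul_finrank_map_siegel`: `2·dim emb_i(Siegel_{m_i}) =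
  m_i(m_i+1)`** (the embedding is injective), `finrank_siegel_le_finrank_ker_hankelBox` (one factor's piece).
* §4 **ALL FACTORS TOGETHER**: the product Siegel family `{emb_i(s^{(i)}_{ab})}` is LINEARLY INDEPENDENT (`linearIndependent_bsgen`; coordinates
  transport along the block embeddings, `coord_map_emb`), **`siegelBox_le_ker`: SiegelBox := ⊕_i emb_i(Siegel_{m_i}) ≤ ker(θ ↦ θ ∧ F ∣ ⋀²)**,
  **`two_mul_finrank_siegelBox`: `2·dim SiegelBox = Σ_i m_i(m_i+1)`**, hence **`finrank_siegelBox_le_finrank_ker`: `dim ker ≥ Σ_i m_i(m_i+1)/2`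
  for EVERY Hankel box** — when every `m_i ≥ 4` this is exactly the numeric floor `C(Σ 2m_i, 2) − [t²] Π_i G_{m_i}` of `WedgeHankelBoxFaces` §6
  (`G_m = 1 + 2m t + 3C(m,2) t² + …`; the cross terms `4m_im_j` cancel, `C(2m,2) − 3C(m,2) = m(m+1)/2`); for factors of dimension `≤ 3` the generic
  degree-2 kernel is LARGER than the Siegel part (e.g. `m = 2`: floor `5 > 3`).
NOT typed (honest): the equality `ker = SiegelBox` for the box of middle powers with all `m_i ≥ 4` (numerically forced by §6 there; the arithmetic
identity is not re-derived here); the excess kernel for small factors; higher degrees; anything Ext-side.  Class side only.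
Namespace `Summit.Ventures.HSemireg.Wedge.HankelBox` (continued); new names only.
-/

open Module

namespace Summit.Ventures.HSemireg.Wedge.HankelBox

open Summit.Ventures.HSemireg.Wedge Summit.Ventures.HSemireg.Wedge.Kunneth Summit.Ventures.HSemireg.Wedge.MixedBox
  Summit.Ventures.HSemireg.Wedge.HankelSiegel

variable (K : Type*) [Field K]

/-! ## §1. Even homogeneous elements commute with homogeneous elements -/

section Even

variable {I : Type*} [LinearOrder I] [Fintype I]

/-- an element of `Hom D 2` commutes with every homogeneous element (any index type; `B_mul_comm_of_mem_Hom` with `(−1)^{2d} = 1`). -/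
lemma even_mul_comm {D D' : Finset I} {d : ℕ} {θ f : HT K I} (hθ : θ ∈ Hom K I D 2) (hf : f ∈ Hom K I D' d) : θ * f = f * θ := by
  induction hθ using Submodule.span_induction with
  | mem x hx =>
    obtain ⟨t, ht, rfl⟩ := hx
    rw [B_mul_comm_of_mem_Hom K hf t, ht.2, show (-1 : K) ^ (2 * d) = 1 by rw [pow_mul, neg_one_sq, one_pow], one_smul]
  | zero => rw [zero_mul, mul_zero]
  | add x y _ _ hx hy => rw [add_mul, mul_add, hx, hy]
  | smul c x _ hx => rw [smul_mul_assoc, mul_smul_comm, hx]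

end Even

/-- the Siegel space is homogeneous of degree `2` on all generators. -/
lemma siegel_le_Hom_two (k : ℕ) : siegel K k ≤ Hom K (Hankel.In k) Finset.univ 2 := by
  rw [siegel, Submodule.span_le]
  rintro _ ⟨p, rfl⟩
  exact sv_mem_Hom_two K _ _

/-! ## §2. The embedded Siegel 2-vectors of factor `i` kill the Hankel box -/

section Box

variable {n : ℕ} (m : Fin n → ℕ)

/-- every initial product `v₀ ∧ ⋯ ∧ v_{j−1}` of Hankel factors is homogeneous (on the first `j` blocks). -/
lemma prodR_hfac_mem_Hom (q : Fin n → ℕ → K) {j : ℕ} (hj1 : 1 ≤ j) (hjn : j ≤ n) :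
    prodR K (hfac K m q) j ∈ Hom K (Gen m) ((Finset.range j).biUnion (blk m))
      (∑ i ∈ Finset.range j, if h : i < n then m ⟨i, h⟩ else 0) :=
  (rankPoly_prodR K (f := hfac K m q) (d := fun i => if h : i < n then m ⟨i, h⟩ else 0)
    (fun i hi => by rw [dif_pos hi]; exact hfac_mem_Hom K m q hi) (blk_disjoint m) j hj1 hjn).1

/-- the embedded Siegel 2-vector of factor `i` kills every initial product that contains factor `i`. -/
lemma emb_mul_prodR_hfac_eq_zero (q : Fin n → ℕ → K) {i : ℕ} (hi : i < n) {θ₀ : HT K (Hankel.In (m ⟨i, hi⟩))}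
    (hθ : θ₀ ∈ siegel K (m ⟨i, hi⟩)) : ∀ k, i < k → k ≤ n → emb K (facEmb m ⟨i, hi⟩) θ₀ * prodR K (hfac K m q) k = 0 := by
  intro k hik hkn
  obtain ⟨d, rfl⟩ : ∃ d, k = i + 1 + d := ⟨k - (i + 1), by omega⟩
  induction d with
  | zero =>
    rw [add_zero, prodR_succ]
    have hθ2 : emb K (facEmb m ⟨i, hi⟩) θ₀ ∈ Hom K (Gen m) (Finset.univ.map (facEmb m ⟨i, hi⟩).toEmbedding) 2 :=
      emb_mem_Hom K _ (siegel_le_Hom_two K _ hθ)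
    have hkill : emb K (facEmb m ⟨i, hi⟩) θ₀ * hfac K m q i = 0 := by
      rw [hfac, dif_pos hi, ← map_mul, mul_w_eq_zero_of_mem_siegel K hθ, map_zero]
    rcases Nat.eq_zero_or_pos i with hi0 | hipos
    · subst hi0
      rw [show prodR K (hfac K m q) 0 = 1 from rfl, one_mul, hkill]
    · rw [← mul_assoc, even_mul_comm K hθ2 (prodR_hfac_mem_Hom K m q hipos hi.le), mul_assoc, hkill, mul_zero]
  | succ d ih =>
    rw [show i + 1 + (d + 1) = (i + 1 + d) + 1 by omega, prodR_succ, ← mul_assoc, ih (by omega) (by omega), zero_mul]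

/-- **THE SIEGEL DIRECTIONS OF FACTOR `i` KILL THE HANKEL BOX: `emb_i(θ₀) ∧ (v₀ ∧ ⋯ ∧ v_{n−1}) = 0`** for every `θ₀ ∈ Siegel_{m_i}`, every `i < n`
and EVERY sequences `q` (every field, every dimensions). -/
theorem emb_siegel_mul_hankelBox (q : Fin n → ℕ → K) {i : ℕ} (hi : i < n) {θ₀ : HT K (Hankel.In (m ⟨i, hi⟩))}
    (hθ : θ₀ ∈ siegel K (m ⟨i, hi⟩)) : emb K (facEmb m ⟨i, hi⟩) θ₀ * hankelBox K m q = 0 :=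
  emb_mul_prodR_hfac_eq_zero K m q hi hθ n hi le_rfl

/-! ## §3. The embedded Siegel space inside the kernel -/

/-- the embedded Siegel space of factor `i` lies in `⋀²`. -/
lemma map_siegel_le_exteriorPower {i : ℕ} (hi : i < n) :
    (siegel K (m ⟨i, hi⟩)).map (emb K (facEmb m ⟨i, hi⟩)).toLinearMap ≤ ⋀[K]^2 (Gen m → K) := by
  rw [Submodule.map_le_iff_le_comap]
  intro θ hθ
  have h2 : θ ∈ Hom K (Hankel.In (m ⟨i, hi⟩)) Finset.univ 2 := siegel_le_Hom_two K _ hθ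
  rw [Submodule.mem_comap, AlgHom.toLinearMap_apply, exteriorPower_eq_span]
  have := emb_mem_Hom K (facEmb m ⟨i, hi⟩) h2
  rw [Hom] at this
  refine Submodule.span_mono ?_ this
  rintro _ ⟨s, hs, rfl⟩
  exact ⟨s, hs.2, rfl⟩

/-- **`emb_i(Siegel_{m_i}) ≤ ker(θ ↦ θ ∧ F ∣ ⋀²)` for every factor `i < n` and EVERY classes** (along the inclusion of `⋀²`). -/
theorem map_siegel_le_ker_hankelBox (q : Fin n → ℕ → K) {i : ℕ} (hi : i < n) :
    ((siegel K (m ⟨i, hi⟩)).map (emb K (facEmb m ⟨i, hi⟩)).toLinearMap).comap (⋀[K]^2 (Gen m → K)).subtype ≤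
      LinearMap.ker (wedge K (Gen m) 2 (hankelBox K m q)) := by
  intro θ hθ
  rw [Submodule.mem_comap, Submodule.mem_map] at hθ
  obtain ⟨θ₀, hθ₀, hθeq⟩ := hθ
  rw [LinearMap.mem_ker, wedge, LinearMap.comp_apply, LinearMap.mulRight_apply, ← hθeq, AlgHom.toLinearMap_apply]
  exact emb_siegel_mul_hankelBox K m q hi hθ₀

/-- **`2 · dim emb_i(Siegel_{m_i}) = m_i(m_i+1)`**: the block embedding is injective. -/
theorem two_mul_finrank_map_siegel {i : ℕ} (hi : i < n) :
    2 * finrank K ((siegel K (m ⟨i, hi⟩)).map (emb K (facEmb m ⟨i, hi⟩)).toLinearMap) = m ⟨i, hi⟩ * (m ⟨i, hi⟩ + 1) := by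
  rw [← two_mul_finrank_siegel K (n := m ⟨i, hi⟩)]
  congr 1
  exact (Submodule.equivMapOfInjective (emb K (facEmb m ⟨i, hi⟩)).toLinearMap (emb_injective K (facEmb m ⟨i, hi⟩))
    (siegel K (m ⟨i, hi⟩))).finrank_eq.symm

/-- **A NAMED KERNEL PIECE FOR EVERY HANKEL BOX AND EVERY FACTOR: `dim ker(θ ↦ θ ∧ F ∣ ⋀²) ≥ dim Siegel_{m_i}`** (`= m_i(m_i+1)/2`; every field,
every `n`, every dimensions, EVERY classes `q`). -/
theorem finrank_siegel_le_finrank_ker_hankelBox (q : Fin n → ℕ → K) {i : ℕ} (hi : i < n) :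
    finrank K (siegel K (m ⟨i, hi⟩)) ≤ finrank K (LinearMap.ker (wedge K (Gen m) 2 (hankelBox K m q))) := by
  rw [(Submodule.equivMapOfInjective (emb K (facEmb m ⟨i, hi⟩)).toLinearMap (emb_injective K (facEmb m ⟨i, hi⟩))
      (siegel K (m ⟨i, hi⟩))).finrank_eq,
    ← (Submodule.comapSubtypeEquivOfLe (map_siegel_le_exteriorPower K m hi)).finrank_eq]
  exact Submodule.finrank_mono (map_siegel_le_ker_hankelBox K m q hi)

/-! ## §4. All factors together: the product Siegel family is linearly independent -/

/-- coordinates of a basis monomial. -/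
lemma coord_B_B {J : Type*} [LinearOrder J] [Fintype J] (s t : Finset J) : (B K J).coord t (B K J s) = if s = t then 1 else 0 := by
  rw [Basis.coord_apply, Basis.repr_self, Finsupp.single_apply]

/-- coordinates transport along a block embedding: `coord_{t.map φ}(emb φ v) = coord_t(v)`. -/
lemma coord_map_emb {I J : Type*} [LinearOrder I] [Fintype I] [LinearOrder J] [Fintype J] (φ : J ↪o I) (t : Finset J)
    (v : HT K J) : (B K I).coord (t.map φ.toEmbedding) (emb K φ v) = (B K J).coord t v := by
  have key : (B K I).coord (t.map φ.toEmbedding) ∘ₗ (emb K φ).toLinearMap = (B K J).coord t := by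
    apply (B K J).ext
    intro s
    rw [LinearMap.comp_apply, AlgHom.toLinearMap_apply, emb_B, coord_B_B, coord_B_B]
    simp only [(Finset.map_injective φ.toEmbedding).eq_iff]
  rw [← key, LinearMap.comp_apply, AlgHom.toLinearMap_apply]

/-- the PRODUCT SIEGEL FAMILY: every embedded symmetric 2-vector `emb_i(s^{(i)}_{ab})` of every factor. -/
noncomputable def bsgen (x : Σ i : Fin n, SIdx (m i)) : HT K (Gen m) := emb K (facEmb m x.1) (sgen K x.2)

/-- a non-empty monomial of block `i` is not supported on block `j ≠ i`. -/
lemma not_subset_block {i j : Fin n} (hij : j ≠ i) (t : Finset (Hankel.In (m i))) (ht : t.Nonempty) :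
    ¬ (t.map (facEmb m i).toEmbedding ⊆ Finset.univ.map (facEmb m j).toEmbedding) := by
  intro h
  obtain ⟨x, hx⟩ := ht
  have hmem := h (Finset.mem_map_of_mem (facEmb m i).toEmbedding hx)
  rw [Finset.mem_map] at hmem
  obtain ⟨y, -, hy⟩ := hmem
  have h1 := congrArg (fun z => (ofLex z).1) hy
  simp only [RelEmbedding.coe_toEmbedding, facEmb_apply, ofLex_toLex] at h1
  exact hij h1

/-- the coordinates of another block's embedded symmetric 2-vectors vanish at a block-`i` monomial. -/
lemma coord_bsgen_of_ne {i j : Fin n} (hij : j ≠ i) (t : Finset (Hankel.In (m i))) (ht : t.Nonempty) (p : SIdx (m j)) :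
    (B K (Gen m)).coord (t.map (facEmb m i).toEmbedding) (bsgen K m ⟨j, p⟩) = 0 := by
  apply coord_eq_zero_of_mem_Hom K (emb_mem_Hom K (facEmb m j) (sv_mem_Hom_two K (p.2 : ℕ) (p.1 : ℕ)))
  intro h
  exact not_subset_block m hij t ht h.1

/-- **THE PRODUCT SIEGEL FAMILY IS LINEARLY INDEPENDENT** (leading monomials `{x^{(i)}_a, y^{(i)}_b}`: distinct blocks, or distinct
within a block). -/
theorem linearIndependent_bsgen : LinearIndependent K (bsgen K m) := by
  classical
  rw [linearIndependent_iff']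
  intro s g hsum x₀ hx₀
  obtain ⟨i, ⟨b, a⟩⟩ := x₀
  have ha : (a : ℕ) < m i := by have := a.2; omega
  have hab : (a : ℕ) ≤ (b : ℕ) := by have := a.2; omega
  set t : Finset (Hankel.In (m i)) := {Hankel.xI (a : ℕ) ha, Hankel.yI (b : ℕ) b.2} with ht
  have htne : t.Nonempty := by rw [ht]; exact Finset.insert_nonempty _ _
  have h := congrArg ((B K (Gen m)).coord (t.map (facEmb m i).toEmbedding)) hsum
  rw [map_sum, map_zero] at h
  simp_rw [map_smul] at h
  rw [Finset.sum_eq_single ⟨i, ⟨b, a⟩⟩] at h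
  · rw [bsgen, coord_map_emb, sgen, coord_sv K ha b.2 ha b.2 hab hab, if_pos ⟨rfl, rfl⟩, smul_eq_mul, mul_eq_zero] at h
    exact h.resolve_right ((u_ne_zero_iff K).mpr (Finset.disjoint_singleton.mpr (xI_ne_yI' ha b.2)))
  · rintro ⟨j, ⟨b', a'⟩⟩ _ hne
    by_cases hji : j = i
    · subst hji
      have ha' : (a' : ℕ) < m j := by have := a'.2; omega
      have hab' : (a' : ℕ) ≤ (b' : ℕ) := by have := a'.2; omega
      rw [bsgen, coord_map_emb, sgen, coord_sv K ha b.2 ha' b'.2 hab hab', if_neg, smul_zero]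
      rintro ⟨h1, h2⟩
      apply hne
      have hb' : b' = b := Fin.ext h2
      subst hb'
      have haa : a' = a := Fin.ext h1
      subst haa
      rfl
    · rw [coord_bsgen_of_ne K m hji t htne ⟨b', a'⟩, smul_zero]
  · intro hx
    exact absurd hx₀ hx

/-- **THE PRODUCT SIEGEL SPACE** `SiegelBox := span{emb_i(s^{(i)}_{ab}) : i < n, a ≤ b < m_i}`. -/
noncomputable def siegelBox : Submodule K (HT K (Gen m)) := Submodule.span K (Set.range (bsgen K m))

/-- the product Siegel space lies in `⋀²`. -/
lemma siegelBox_le_exteriorPower : siegelBox K m ≤ ⋀[K]^2 (Gen m → K) := by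
  rw [siegelBox, Submodule.span_le]
  rintro _ ⟨⟨i, p⟩, rfl⟩
  exact map_siegel_le_exteriorPower K m i.2 ⟨sgen K p, Submodule.subset_span ⟨p, rfl⟩, rfl⟩

/-- every element of the product Siegel space kills the Hankel box. -/
theorem mul_hankelBox_eq_zero_of_mem_siegelBox {θ : HT K (Gen m)} (hθ : θ ∈ siegelBox K m) (q : Fin n → ℕ → K) :
    θ * hankelBox K m q = 0 := by
  induction hθ using Submodule.span_induction with
  | mem x hx =>
    obtain ⟨⟨i, p⟩, rfl⟩ := hx
    exact emb_siegel_mul_hankelBox K m q i.2 (Submodule.subset_span ⟨p, rfl⟩)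
  | zero => rw [zero_mul]
  | add x y _ _ hx hy => rw [add_mul, hx, hy, add_zero]
  | smul c x _ hx => rw [smul_mul_assoc, hx, smul_zero]

/-- **`SiegelBox ≤ ker(θ ↦ θ ∧ (v₀ ∧ ⋯ ∧ v_{n−1}) ∣ ⋀²)` for EVERY classes `q`** (every field, every `n`, every dimensions). -/
theorem siegelBox_le_ker (q : Fin n → ℕ → K) :
    (siegelBox K m).comap (⋀[K]^2 (Gen m → K)).subtype ≤ LinearMap.ker (wedge K (Gen m) 2 (hankelBox K m q)) := by
  intro θ hθ
  rw [LinearMap.mem_ker, wedge, LinearMap.comp_apply, Submodule.subtype_apply, LinearMap.mulRight_apply]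
  exact mul_hankelBox_eq_zero_of_mem_siegelBox K m hθ q

/-- **`2 · dim SiegelBox = Σ_i m_i(m_i+1)`** (the `n` embedded Siegel spaces are in direct sum). -/
theorem two_mul_finrank_siegelBox : 2 * finrank K (siegelBox K m) = ∑ i : Fin n, m i * (m i + 1) := by
  rw [siegelBox, finrank_span_eq_card (linearIndependent_bsgen K m), Fintype.card_sigma, Finset.mul_sum]
  exact Finset.sum_congr rfl fun i _ => two_mul_card_SIdx (n := m i)

/-- **A NAMED KERNEL FLOOR FOR EVERY HANKEL BOX: `dim ker(θ ↦ θ ∧ F ∣ ⋀²) ≥ dim SiegelBox = Σ_i m_i(m_i+1)/2`** — every field, `n`,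
dimensions, EVERY classes; for all `m_i ≥ 4` this number is `C(Σ 2m_i, 2) − [t²] Π_i G_{m_i}`, the numeric floor of `WedgeHankelBoxFaces` §6
(attained by the box of middle powers, where therefore the kernel IS `SiegelBox` — not re-derived here). -/
theorem finrank_siegelBox_le_finrank_ker (q : Fin n → ℕ → K) :
    finrank K (siegelBox K m) ≤ finrank K (LinearMap.ker (wedge K (Gen m) 2 (hankelBox K m q))) := by
  rw [← (Submodule.comapSubtypeEquivOfLe (siegelBox_le_exteriorPower K m)).finrank_eq]
  exact Submodule.finrank_mono (siegelBox_le_ker K m q)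

end Box

end Summit.Ventures.HSemireg.Wedge.HankelBox
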